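import Literature.AnabelianGeometry.AbsoluteAnabelian.AbsTopIII.CurveModelSchemaWitnesses
import Literature.AnabelianGeometry.AbsoluteAnabelian.AbsTopIII.CuspidalCyclotomeKummerUnitsClosureRefutations
import Literature.AnabelianGeometry.AbsoluteAnabelian.AbsCuspFactsProp16iiiReduction
import Literature.AnabelianGeometry.AbsoluteAnabelian.GaloisSectionsFactsThm13iiSchema
import Literature.AnabelianGeometry.AbsoluteAnabelian.GaloisSectionsFactsThm13iiCusps
import Literature.AnabelianGeometry.AbsoluteAnabelian.MLFGaloisTypeProofs
import HarnessLib

/-!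
# Instance forms of four `CurveModel`-relative named facts at the tree's NAMED toy interfaces

S. Mochizuki, *Topics in Absolute Anabelian Geometry III*, §1, Prop. 1.4 (i) p. 31 [MochizukiAbsTopIII2015];
*Galois sections in absolute anabelian geometry* (2005), Thm. 1.3 (ii) p. 6 [MochizukiGalSect2005];
*Absolute anabelian cuspidalizations of proper hyperbolic curves* (2007), Prop. 1.6 (iii) p. 15
[MochizukiAbsCusp2007].  Cell abc-iut, block F, seat abc-iut-f-033 (gen 6), KEY row INST59B; PROOF-ONLY
companion (no definition, no instance, no `Prop` fact) of `AbsTopIII/CurveModel.lean` and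
`CuspidalizationFactsModel.lean` (imported, never edited).

THE ROWS (FACT-LIST F-0339 `CurveModel.Prop_1_4_i`, F-0340 `CurveModel.Prop_1_4_i'`, F-0084
`GalSect.Thm_1_3_ii_model`, F-0045 `AbsCusp.Prop_1_6_iii_model`) are named facts RELATIVE TO an interface
`M : AbsTopIII.CurveModel`.  Their universal closures over ALL interfaces are refuted in the tree
(`CurveModel.not_forall_prop_1_4_i`, `CurveModel.not_forall_prop_1_4_i'`, `GalSect.not_forall_thm_1_3_ii_model`,
`AbsCusp.not_forall_prop_1_6_iii_model`), and f-056's `CurveModel.exists_facts_nonVacuous` witnesses them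
JOINTLY by an `∃ M` statement.  This file adds what the kernel census of the cell reads as INSTANCE FORMS:
theorems whose conclusion IS the row's declaration applied to a NAMED interface of the tree — the toy
interface `CurveModelSchemaWitness.toyModel k H` (one curve over `k`, `Π := G_k × H ↠ G_k`, one cusp with
`D = Π`, `I = Δ = {1} × H`, `res :=` "kill `H`") and the junk interface
`(KummerUnitsClosureWitness.model k).toCurveModel` (one curve over `k`, `Π := G_k × Ẑ`, one cusp `D = Π`,
`I = Δ ≅ Ẑ`, one closed point with `D = Π`).

* F-0339 — `CurveModel.prop_1_4_i_toyModel_zHat`, `CurveModel.prop_1_4_i_kummerUnitsModel`: at `H = Ẑ`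
  (Mathlib's profinite completion of `ℤ`, resp. `∏_p ℤ_p`) the single cusp's inertia group `I = Δ ≅ Ẑ` IS
  free procyclic — the instance spared by the refuter's trivial-inertia toy (`not_forall_prop_1_4_i`);
  NON-degenerate in the row's own currency (a scheme-flagged curve with a cusp whose `I ≅ Ẑ`).
* F-0084 — `GalSect.thm_1_3_ii_model_kummerUnitsModel`: at `Π = G_k × Ẑ` every subgroup of the central
  factor `Δ = {1} × Ẑ` is normal, so `C_Π(H) = Π = D_x` for every (open) `H ⊆ I_x` — the cusp clause of
  Thm. 1.3 (ii) holds with content; the point clause holds because the one closed point has `D = Π`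
  (degenerate).  The `IsMLF` binder fires at `k = ℚ_p` (`isMLF_padic`): `…_padic`.
* F-0340 — `CurveModel.prop_1_4_i'_toyModel_punit`: at `H = 1` the "cuspidal quotient" `res` is the identity,
  hence surjective, `G → G` is the identity, and `Ker(res) = Δ` is the closed normal closure of the single
  cusp's inertia group (`S = {x}`).  DEGENERATE (`Δ = 1`): both named interfaces have `res` = "kill the
  `Δ`-factor", which is surjective only for `Δ = 1` (for `H = 𝔖₃` it is the refuter's counterexample).
* F-0045 — `AbsCusp.prop_1_6_iii_model_toyModel_punit` (+ `…_padic`): by f-079/f-094's one-cusp reduction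
  `prop_1_6_iii_iff_of_subsingleton` the row at a single-cusp open is "`res` surjective ∧
  `1 → I → Δ^{c-cn} → Δ_X → 1` exact"; the exactness holds at EVERY commutative `H`
  (`isCuspidallyCentralExtension_toyKill_of_comm`), surjectivity forces `H = 1`.  DEGENERATE (`Δ = 1`); the
  binders (`X` proper, base an MLF at `k = ℚ_p`, the cusp rational) all fire.

HONEST LABEL: toy / junk interfaces, not models of any hyperbolic curve; instance forms are statements about
OUR typing of the interface (the hypothesis package is satisfiable at named data, non-vacuously), nothing
about print, whose content (étale `π₁`) stays a named input at the intended instance.  A non-degenerate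
named instance of F-0340 / F-0045 would need a NAMED interface with a genuinely ramified cuspidal quotient
(e.g. a once-punctured-torus builder as a `def`), i.e. a reviewed definition — out of scope for a proof-only
file.  Refereed results typed statements-first (D-0014); typed ≠ proved; refuted-as-typed ≠ refuted-in-print;
nothing here bears on [IUTchIII] Cor. 3.12; no side taken.
-/

noncomputable section

open scoped Pointwise

namespace Literature.AnabelianGeometry.AbsoluteAnabelian

open AbsTopIII CategoryTheory FundamentalExtension

/-! ### F-0339: `Prop_1_4_i` at the toy interfaces with `Δ ≅ Ẑ` -/

namespace AbsTopIII.CurveModel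

open CurveModelSchemaWitness

/-- **F-0339, instance form.**  In the toy interface over any field `k` of characteristic zero with
`H = Ẑ` (profinite completion of `ℤ`), every cuspidal inertia group of every (scheme-flagged) curve is free
procyclic: the single cusp has `I = Δ = {1} × Ẑ ≅ Ẑ`.  [AbsTopIII] Prop. 1.4 (i), first clause ("`I_x` is
naturally isomorphic to `Ẑ(1)`"), at named toy data. [cite: MochizukiAbsTopIII2015, Prop 1.4 (i) p.31] -/
theorem prop_1_4_i_toyModel_zHat (k : Type) [Field k] [CharZero k] : (toyModel k ZHat).Prop_1_4_i :=
  fun _ _ x => isFreeProcyclic_Icusp_zHat k x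

/-- **F-0339, instance form (closed, over `ℚ`).** [cite: MochizukiAbsTopIII2015, Prop 1.4 (i) p.31] -/
theorem prop_1_4_i_toyModel_rat_zHat : (toyModel ℚ ZHat).Prop_1_4_i :=
  prop_1_4_i_toyModel_zHat ℚ

/-- **F-0339, instance form at the junk Kummer interface** `Π = G_k × ∏_p ℤ_p` of
`CuspidalCyclotomeKummerUnitsClosureRefutations`: the single cusp's inertia group `I = Δ ≅ ∏_p ℤ_p` is free
procyclic (`KummerUnitsClosureWitness.isFreeProcyclic_geom`). [cite: MochizukiAbsTopIII2015, Prop 1.4 (i) p.31] -/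
theorem prop_1_4_i_kummerUnitsModel (k : Type) [Field k] [CharZero k] :
    (KummerUnitsClosureWitness.model k).toCurveModel.Prop_1_4_i :=
  fun _ _ _ => KummerUnitsClosureWitness.isFreeProcyclic_geom k

/-! ### F-0340: `Prop_1_4_i'` at the toy interface with `Δ = 1` -/

/-- At `H = 1` the killing map `(g, h) ↦ (g, 1)` is the identity. [cite: MochizukiAbsTopIII2015, Prop 1.4 (i) p.31] -/
private theorem toyKill_punit_apply (k : Type) [Field k] [CharZero k]
    (x : Field.absoluteGaloisGroup k × ProfiniteGrp.of PUnit.{1}) :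
    (toyKill k (ProfiniteGrp.of PUnit.{1})).arith x = x :=
  Prod.ext rfl (Subsingleton.elim _ _)

/-- At `H = 1` the killing map is surjective. [cite: MochizukiAbsTopIII2015, Prop 1.4 (i) p.31] -/
private theorem toyKill_punit_surjective (k : Type) [Field k] [CharZero k] :
    Function.Surjective (toyKill k (ProfiniteGrp.of PUnit.{1})).arith :=
  fun y => ⟨y, toyKill_punit_apply k y⟩

/-- In every toy interface the kernel of the "cuspidal quotient" is the closed normal closure of the
inertia groups of the set `{x}` of cusps (`Ker = Δ = I_x`, closed and normal).
[cite: MochizukiAbsTopIII2015, Prop 1.4 (i) p.31] -/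
theorem ker_toyKill_eq_closure_biUnion (k : Type) [Field k] [CharZero k] (H : ProfiniteGrp.{0}) :
    (toyKill k H).arith.toMonoidHom.ker =
      (Subgroup.normalClosure
        (⋃ c ∈ (Set.univ : Set (topCusps (toyExt k H)).Cusp),
          ((topCusps (toyExt k H)).Icusp c : Set (toyExt k H).arith))).topologicalClosure := by
  have hU : (⋃ c ∈ (Set.univ : Set (topCusps (toyExt k H)).Cusp),
      ((topCusps (toyExt k H)).Icusp c : Set (toyExt k H).arith)) =
        ((topCusps (toyExt k H)).Icusp PUnit.unit : Set (toyExt k H).arith) := by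
    ext y
    simp only [Set.mem_iUnion, Set.mem_univ, exists_true_left, SetLike.mem_coe]
    exact ⟨fun ⟨_, h⟩ => h, fun h => ⟨PUnit.unit, h⟩⟩
  rw [hU, ker_toyKill, ← cuspidalKernel_toyKill, cuspidalKernel_toyKill_eq_closure k H PUnit.unit]

/-- **F-0340, instance form (DEGENERATE, `Δ = 1`).**  In the toy interface with `H = 1` the restriction
`Π_U ↠ Π_{U'}` is surjective, `G → G` is bijective, and its kernel is the closed normal closure of the
inertia groups of the cusps in `S = {x}`: [AbsTopIII] Prop. 1.4 (i), second clause, at named toy data.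
(At `H = 𝔖₃` the same interface refutes the universal closure, `CurveModel.not_forall_prop_1_4_i'`.)
[cite: MochizukiAbsTopIII2015, Prop 1.4 (i) p.31] -/
theorem prop_1_4_i'_toyModel_punit (k : Type) [Field k] [CharZero k] :
    (toyModel k (ProfiniteGrp.of PUnit.{1})).Prop_1_4_i' :=
  fun _ _ _ _ _ =>
    ⟨toyKill_punit_surjective k, Function.bijective_id, Set.univ,
      ker_toyKill_eq_closure_biUnion k (ProfiniteGrp.of PUnit.{1})⟩

/-- **F-0340, instance form (closed, over `ℚ`; DEGENERATE).** [cite: MochizukiAbsTopIII2015, Prop 1.4 (i) p.31] -/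
theorem prop_1_4_i'_toyModel_rat_punit : (toyModel ℚ (ProfiniteGrp.of PUnit.{1})).Prop_1_4_i' :=
  prop_1_4_i'_toyModel_punit ℚ

end AbsTopIII.CurveModel

/-! ### F-0084: `Thm_1_3_ii_model` at the junk interface `Π = G_k × Ẑ` -/

namespace GalSect

/-- In `Π = G_k × Ẑ` (`Ẑ = ∏_p ℤ_p` commutative) every subgroup of `Δ = {1} × Ẑ` is central, hence normal.
[cite: MochizukiGalSect2005, Thm 1.3 (ii) p.6] -/
private theorem normal_of_le_geom (k : Type) [Field k] [CharZero k]
    (H : Subgroup (KummerUnitsClosureWitness.ext k).arith) (hH : H ≤ (KummerUnitsClosureWitness.ext k).geom) :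
    H.Normal := by
  refine ⟨fun h hh g => ?_⟩
  have h1 : h.1 = 1 := (KummerUnitsClosureWitness.mem_geom_iff k h).mp (hH hh)
  have hgh : g * h * g⁻¹ = h := by
    refine Prod.ext ?_ ?_
    · change g.1 * h.1 * g.1⁻¹ = h.1
      rw [h1, mul_one, mul_inv_cancel]
    · change g.2 * h.2 * g.2⁻¹ = h.2
      rw [mul_comm g.2 h.2, mul_inv_cancel_right]
  rw [hgh]
  exact hh

/-- In `Π = G_k × Ẑ` the commensurator of any subgroup of `Δ = {1} × Ẑ` is all of `Π`.
[cite: MochizukiGalSect2005, Thm 1.3 (ii) p.6] -/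
theorem commensurator_eq_top_of_le_geom (k : Type) [Field k] [CharZero k]
    (H : Subgroup (KummerUnitsClosureWitness.ext k).arith) (hH : H ≤ (KummerUnitsClosureWitness.ext k).geom) :
    Subgroup.Commensurable.commensurator H = ⊤ := by
  haveI hN : H.Normal := normal_of_le_geom k H hH
  refine eq_top_iff.mpr fun g _ => (Subgroup.Commensurable.commensurator_mem_iff H g).mpr ?_
  rw [hN.conjAct]

/-- **F-0084, instance form.**  At the junk interface `(KummerUnitsClosureWitness.model k).toCurveModel`
(`Π = G_k × Ẑ ↠ G_k`, one cusp `D = Π`, `I = Δ ≅ Ẑ`, one closed point `D = Π`) the model-relative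
[GalSect] Thm. 1.3 (ii) holds: the closed point's `D = Π` is commensurably terminal (degenerate clause), and
for the CUSP, `D_x = Π = C_Π(H)` for every open subgroup `H ⊆ I_x` because `I_x = Δ` is central
(the clause with content).  The `IsMLF` binder fires at `k = ℚ_p`. [cite: MochizukiGalSect2005, Thm 1.3 (ii) p.6] -/
theorem thm_1_3_ii_model_kummerUnitsModel (k : Type) [Field k] [CharZero k]
    (hclosed : ∀ (U : (KummerUnitsClosureWitness.model k).Curve)
      (x : (KummerUnitsClosureWitness.model k).Point U),
      IsClosed ((KummerUnitsClosureWitness.model k).decomp U x :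
        Set ((KummerUnitsClosureWitness.model k).ext U).arith)) :
    Thm_1_3_ii_model (KummerUnitsClosureWitness.model k).toCurveModel hclosed := by
  intro U _
  refine ⟨thm_1_3_ii_points_of_decomp_eq_top _ fun _ => rfl,
    thm_1_3_ii_cusps_of_forall_commensurator_eq _ fun x H hH _ _ => ?_⟩
  exact commensurator_eq_top_of_le_geom k H hH

/-- The decomposition groups of the junk interface (`D = Π`) are closed.
[cite: MochizukiGalSect2005, §1 p.6] -/
theorem isClosed_decomp_kummerUnitsModel (k : Type) [Field k] [CharZero k]
    (U : (KummerUnitsClosureWitness.model k).Curve) (x : (KummerUnitsClosureWitness.model k).Point U) :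
    IsClosed ((KummerUnitsClosureWitness.model k).decomp U x :
      Set ((KummerUnitsClosureWitness.model k).ext U).arith) := by
  change IsClosed ((⊤ : Subgroup (KummerUnitsClosureWitness.ext k).arith) :
    Set (KummerUnitsClosureWitness.ext k).arith)
  rw [Subgroup.coe_top]
  exact isClosed_univ

/-- **F-0084, instance form over the MLF `ℚ_p` (closed; the `IsMLF` binder fires by `isMLF_padic`).**
[cite: MochizukiGalSect2005, Thm 1.3 (ii) p.6] -/
theorem thm_1_3_ii_model_kummerUnitsModel_padic (p : ℕ) [Fact p.Prime] :
    Thm_1_3_ii_model (KummerUnitsClosureWitness.model ℚ_[p]).toCurveModel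
      (isClosed_decomp_kummerUnitsModel ℚ_[p]) :=
  thm_1_3_ii_model_kummerUnitsModel ℚ_[p] _

/-- Non-vacuity of the preceding instance: its `IsMLF` binder is met by the single curve's base `ℚ_p`.
[cite: MochizukiGalSect2005, Thm 1.3 (ii) p.6] -/
theorem isMLF_base_kummerUnitsModel_padic (p : ℕ) [Fact p.Prime]
    (U : (KummerUnitsClosureWitness.model ℚ_[p]).Curve) :
    IsMLF ((KummerUnitsClosureWitness.model ℚ_[p]).base U) :=
  isMLF_padic p

end GalSect

/-! ### F-0045: `Prop_1_6_iii_model` at the toy interface with `Δ = 1` -/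

namespace AbsCusp

open CurveModelSchemaWitness

/-- **F-0045, instance form (DEGENERATE, `Δ = 1`).**  In the toy interface with `H = 1` every cofinite
open `U_S ⊆ X` has ONE cusp, rational, and the typed [AbsCusp] Prop. 1.6 (iii) for `Π_{U_S} ↠ Π_X` is, by the
one-cusp reduction `prop_1_6_iii_iff_of_subsingleton`, "`res` surjective ∧ `1 → I → Δ^{c-cn} → Δ_X → 1`
exact"; exactness holds at every commutative `H` (`isCuspidallyCentralExtension_toyKill_of_comm`),
surjectivity at `H = 1`. [cite: MochizukiAbsCusp2007, Prop 1.6 (iii) p.15] -/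
theorem prop_1_6_iii_model_toyModel_punit (k : Type) [Field k] [CharZero k] :
    Prop_1_6_iii_model (toyModel k (ProfiniteGrp.of PUnit.{1})) := by
  intro US X h _ _ _
  haveI : Subsingleton ((toyModel k (ProfiniteGrp.of PUnit.{1})).cusps US).Cusp :=
    inferInstanceAs (Subsingleton PUnit)
  refine (prop_1_6_iii_iff_of_subsingleton _ _ PUnit.unit).mpr ⟨fun y => ⟨y, ?_⟩, ?_⟩
  · exact Prod.ext rfl (Subsingleton.elim _ _)
  · exact isCuspidallyCentralExtension_toyKill_of_comm k _ (fun _ _ => Subsingleton.elim _ _) PUnit.unit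

/-- **F-0045, instance form over the MLF `ℚ_p` (closed; DEGENERATE).**  Here every binder of the row fires:
`X` is flagged proper, the base `ℚ_p` is an MLF (`isMLF_padic`), the cusp is rational
(`isRational_topCusps`). [cite: MochizukiAbsCusp2007, Prop 1.6 (iii) p.15] -/
theorem prop_1_6_iii_model_toyModel_padic_punit (p : ℕ) [Fact p.Prime] :
    Prop_1_6_iii_model (toyModel ℚ_[p] (ProfiniteGrp.of PUnit.{1})) :=
  prop_1_6_iii_model_toyModel_punit ℚ_[p]

/-- Non-vacuity of the preceding instance: the binders `IsProper`, `IsMLF`, "all cusps rational" hold at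
the single curve / cusp of the toy interface over `ℚ_p`. [cite: MochizukiAbsCusp2007, Prop 1.6 (iii) p.15] -/
theorem binders_prop_1_6_iii_model_toyModel_padic (p : ℕ) [Fact p.Prime] (H : ProfiniteGrp.{0})
    (U : (toyModel ℚ_[p] H).Curve) :
    (toyModel ℚ_[p] H).IsProper U ∧ IsMLF ((toyModel ℚ_[p] H).base U) ∧
      ∀ c : ((toyModel ℚ_[p] H).cusps U).Cusp, ((toyModel ℚ_[p] H).cusps U).IsRational c :=
  ⟨trivial, isMLF_padic p, fun c => isRational_topCusps _ c⟩

end AbsCusp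

end Literature.AnabelianGeometry.AbsoluteAnabelian
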